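import Summits.QuantumFields.BalabanUV.T4Continuum.Spine.NE2ColourPerturbedLayer
import Summits.QuantumFields.BalabanUV.T4Continuum.Support.BalabanAveragingPairing
import Summits.QuantumFields.BalabanUV.T4Continuum.Support.CovariantAveragingModel

/-!
# T⁴ programme, spine node NE2 (U1a) — THE REMAINING STATIONS ON THE COLOUR LAYER: the liaison shape `LocalRate` for the colour
# covariances, the `t = 0` identification with the lifted `U = 1` tower, and the rates for Bałaban's averaging `Q̄ ⊗ 1` and for
# transported averagings (tier B of `t4/SKELETON-NE2-P1.md`, row B7 part 1, file 2/2)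

NE2 formalisation swarm, leaf prover 08 (row B7 = assembly), file 2.  File 1 (`Spine/NE2ColourPerturbedLayer`) ported rate / named
limit / NE2-LIP / holomorphy to the colour index `idx L M k × o` for an ARBITRARY perturbation family `P` of the lifted free tower with
`PerturbationLaws (k ↦ Δ_a^{(k)} ⊗ 1) P (k ↦ J_k ⊗ 1) κ (k ↦ C₂L^{−k})`.  Here, for the same class of `P`:

 * §1 **`avgTow_kron`**: the unit-lattice image of a lifted tower is the lift of the unit-lattice image
   (`avgTow (A ⊗ 1) r (X ⊗ 1) k = (avgTow A r X k) ⊗ 1`); hence **`pertCovC_zero_eq_kron`**: at `t = 0` the colour tower IS the lineage's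
   `U = 1` King tower `pertCov … 0 k ⊗ 1` — the perturbation is the only source of colour mixing;
 * §2 the liaison: **`pertReadingsC`** (datum = a perturbation family in the class, sites = pairs of colour unit-lattice indices × re/im)
   and **`localRate_pertCovC`**: `T4EtaRateMin.LocalRate (pertReadingsC κ C₂ t) (Cpert κ (2dCst) CJ C₂ 0 t) L⁻¹` — an INSTANCE of node
   U1b's currency for the colour species, uniformly over the class (port of `PerturbedCovLiaison` §1–§2);
 * §3 other outer averagings, lifted: **`towerLimitRate_perturbed_balaban_kron`** (Bałaban's `Q̄ = QB`, pairing defect `dLCst·L^{−k}`,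
   from `freeTowerLaws_kron o freeTowerLaws_balaban`) and **`towerLimitRate_perturbed_covariant_kron`** (the abelian transported
   averaging `Acov u ⊗ 1` of `CovariantAveragingModel`, `UnimodularTransport u γ`); a genuinely colour-transported outer averaging is
   row B3.a's `Qcov` and plugs into `BackgroundResolventTower.towerLimitRate_perturbed` the same way once its `FreeTowerLaws` are supplied;
 * §4 row B2's non-abelian covariant Laplacian through these stations (`colourCovariantLaplacian_localRate`, `_rate_balaban`,
   `_rate_transported`).

HONEST FRAMING (T4-DAG p. 1).  [folklore] bookkeeping over finite matrices; abstract perturbation family in a GLOBAL small gauge; finite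
torus, linear layer, operator norm; NOT [B9] (3.23)–(3.26) as printed; NE2 NOT proved; NOT infinite volume / mass gap / Clay / summit
progress; spine 0/9 unchanged.  HONEST DEPENDENCY: continuum YM on T⁴ ⇐ BetaPertH ∧ nine spine estimates (0/9 proved); BetaPertH ⇐ (D1)
∧ (D4) ∧ CAP+tail; G-an2-4 gates asym, D1 and NE2/3/4.  ABSOLUTE RULE kept; no `sorry`.
-/

noncomputable section

open scoped BigOperators ComplexConjugate Matrix Matrix.Norms.L2Operator Kronecker
open Filter Topology

namespace Summit.QuantumFields.BalabanUV.T4Continuum.ColourPerturbedStations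

open Literature.MathematicalPhysics.QuantumFieldTheory.Balaban1983to89.B5Prop11Plancherel (Cst Cst_nonneg)
open Literature.MathematicalPhysics.QuantumFieldTheory.Balaban1983to89.T4EtaRateMin (Readings LocalRate)
open Summit.QuantumFields.BalabanUV.T4Continuum
open Summit.QuantumFields.BalabanUV.T4Continuum.CovariantAveragingTower (Atow avgTow TowerLimitRate opNorm_avgTow_succ_sub_le)
open Summit.QuantumFields.BalabanUV.T4Continuum.BalabanAveragedTowerUnit (idx Qlev QBlev calGlev norm_entry_le_opNorm)
open Summit.QuantumFields.BalabanUV.T4Continuum.BackgroundResolventTower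
open Summit.QuantumFields.BalabanUV.T4Continuum.KingPairingPlantedLaw
open Summit.QuantumFields.BalabanUV.T4Continuum.NE2PerturbedLayer
open Summit.QuantumFields.BalabanUV.T4Continuum.FirstOrderBackgroundModel
open Summit.QuantumFields.BalabanUV.T4Continuum.PerturbationAlgebra
open Summit.QuantumFields.BalabanUV.T4Continuum.KroneckerLift
open Summit.QuantumFields.BalabanUV.T4Continuum.ColourCovariantLaplacian
open Summit.QuantumFields.BalabanUV.T4Continuum.BalabanAveragingPairing
open Summit.QuantumFields.BalabanUV.T4Continuum.CovariantAveragingModel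
open Summit.QuantumFields.BalabanUV.T4Continuum.NE2ColourPerturbedLayer

variable {d : ℕ} (L : ℕ) [NeZero L] (M : Fin d → ℕ) [hM : ∀ μ, NeZero (M μ)] (a : ℝ) (ha : 0 < a)
variable {o : Type*} [Fintype o] [DecidableEq o]

/-! ## §1 The unit-lattice image of a lifted tower is the lift of the image -/

section Kron

variable {ι : ℕ → Type*} [∀ k, Fintype (ι k)] [∀ k, DecidableEq (ι k)] (o : Type*) [Fintype o] [DecidableEq o]

/-- `Atow (A ⊗ 1) k = (Atow A k) ⊗ 1`. [folklore] -/
theorem Atow_kron (A : (k : ℕ) → Matrix (ι k) (ι (k + 1)) ℂ) :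
    ∀ k, Atow (fun k => A k ⊗ₖ (1 : Matrix o o ℂ)) k = Atow A k ⊗ₖ (1 : Matrix o o ℂ)
  | 0 => by rw [CovariantAveragingTower.Atow_zero, CovariantAveragingTower.Atow_zero, Matrix.one_kronecker_one]
  | k + 1 => by rw [CovariantAveragingTower.Atow_succ, CovariantAveragingTower.Atow_succ, Atow_kron A k, kron_mul]

/-- **`avgTow (A ⊗ 1) r (X ⊗ 1) k = (avgTow A r X k) ⊗ 1`**: lifting commutes with taking unit-lattice images. [folklore] -/
theorem avgTow_kron (A : (k : ℕ) → Matrix (ι k) (ι (k + 1)) ℂ) (r : ℝ) (X : (k : ℕ) → Matrix (ι k) (ι k) ℂ) (k : ℕ) :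
    avgTow (fun k => A k ⊗ₖ (1 : Matrix o o ℂ)) r (fun k => X k ⊗ₖ (1 : Matrix o o ℂ)) k = avgTow A r X k ⊗ₖ (1 : Matrix o o ℂ) := by
  rw [avgTow, avgTow, Atow_kron, kron_conjTranspose, ← kron_mul, ← kron_mul, Matrix.smul_kronecker]

end Kron

/-- **AT `t = 0` THE COLOUR TOWER IS THE LIFTED `U = 1` KING TOWER**: `pertCovC P 0 k = (pertCov P′ 0 k) ⊗ 1` for any scalar family `P′`
(both sides are the free tower; the perturbation is the only source of colour mixing). [folklore] -/
theorem pertCovC_zero_eq_kron (P : (k : ℕ) → Matrix (idx L M k × o) (idx L M k × o) ℂ)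
    (P' : (k : ℕ) → Matrix (idx L M k) (idx L M k) ℂ) (k : ℕ) :
    pertCovC L M a ha P 0 k = pertCov L M a ha P' 0 k ⊗ₖ (1 : Matrix o o ℂ) := by
  rw [pertCovC_zero, pertCov_zero, ← avgTow_kron]

/-! ## §2 The liaison: `LocalRate` for the colour covariances -/

/-- **ONE STEP OF THE PERTURBED COLOUR TOWER**: `‖c_{k+1}(t) − c_k(t)‖ ≤ Epert(t) k`. [folklore] -/
theorem opNorm_pertCovC_succ_sub_le {P : (k : ℕ) → Matrix (idx L M k × o) (idx L M k × o) ℂ} {κ : ℝ} {e₂ : ℕ → ℝ}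
    (hpert : PerturbationLaws (fun k => calDalev L M a ha k ⊗ₖ (1 : Matrix o o ℂ)) P (fun k => JpcT L M k ⊗ₖ (1 : Matrix o o ℂ)) κ e₂)
    {t : ℂ} (ht : ‖t‖ * κ < 1) (k : ℕ) :
    ‖pertCovC L M a ha P t (k + 1) - pertCovC L M a ha P t k‖
      ≤ Epert κ (fun k => 2 * d * Cst d a * ((L : ℝ)⁻¹) ^ k) (fun k => CJ d a * ((L : ℝ)⁻¹) ^ k) e₂ (fun _ => 0) t k :=
  opNorm_avgTow_succ_sub_le _ (pow_d_pos (d := d) L) (freeTowerLaws_king_kron L M a ha o).opNorm_A_sq_le _ k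
    (oneStepAveragedLaw_perturbed (pow_d_pos (d := d) L) (freeTowerLaws_king_kron L M a ha o) hpert ht k)

/-- geometric form: `‖c_{k+1}(t) − c_k(t)‖ ≤ Cpert(t)·L^{−k}` when `e₂ k = C₂L^{−k}`. [folklore] -/
theorem opNorm_pertCovC_succ_sub_le_geom {P : (k : ℕ) → Matrix (idx L M k × o) (idx L M k × o) ℂ} {κ C₂ : ℝ}
    (hpert : PerturbationLaws (fun k => calDalev L M a ha k ⊗ₖ (1 : Matrix o o ℂ)) P (fun k => JpcT L M k ⊗ₖ (1 : Matrix o o ℂ)) κ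
      (fun k => C₂ * ((L : ℝ)⁻¹) ^ k)) {t : ℂ} (ht : ‖t‖ * κ < 1) (k : ℕ) :
    ‖pertCovC L M a ha P t (k + 1) - pertCovC L M a ha P t k‖ ≤ Cpert κ (2 * d * Cst d a) (CJ d a) C₂ 0 t * ((L : ℝ)⁻¹) ^ k := by
  refine (opNorm_pertCovC_succ_sub_le L M a ha hpert ht k).trans ?_
  refine Epert_le_Cpert ht (fun k => le_rfl) (fun k => le_rfl) (fun k => le_rfl) (fun k => ?_) k
  simp only [zero_mul, le_refl]

/-- THE READINGS of the perturbed colour covariance at coupling `t`: datum = a perturbation family of the lifted free tower in the class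
`PerturbationLaws … κ (C₂L^{−k})`; sites = pairs of colour unit-lattice indices × `Bool` (real / imaginary part); scalar reading and
volume unused (`0`). [folklore] -/
def pertReadingsC (o : Type*) [Fintype o] [DecidableEq o] (κ C₂ : ℝ) (t : ℂ) :
    Readings ((k : ℕ) → Matrix (idx L M k × o) (idx L M k × o) ℂ) (((idx L M 0 × o) × (idx L M 0 × o)) × Bool) where
  dom := {P | PerturbationLaws (fun k => calDalev L M a ha k ⊗ₖ (1 : Matrix o o ℂ)) P (fun k => JpcT L M k ⊗ₖ (1 : Matrix o o ℂ)) κ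
    (fun k => C₂ * ((L : ℝ)⁻¹) ^ k)}
  act := fun _ _ => 0
  loc := fun k P x => if x.2 then ((pertCovC L M a ha P t k) x.1.1 x.1.2).re else ((pertCovC L M a ha P t k) x.1.1 x.1.2).im
  vol := 0
  vol_nonneg := le_rfl

/-- **THE SHAPE `LocalRate` HOLDS FOR THE PERTURBED COLOUR SPECIES**, uniformly over the class: consecutive levels' entries of `c_k(t)`
differ by at most `Cpert(t)·L^{−k}` — an INSTANCE of node U1b's currency (a theorem); the background is carried by the datum.
[cite: King1986, Lemma 4.5 (4.38) p.674 (shape)] [folklore] -/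
theorem localRate_pertCovC (κ C₂ : ℝ) {t : ℂ} (ht : ‖t‖ * κ < 1) :
    LocalRate (pertReadingsC L M a ha o κ C₂ t) (Cpert κ (2 * d * Cst d a) (CJ d a) C₂ 0 t) ((L : ℝ)⁻¹) := by
  intro k P hP x
  have hent : ‖(pertCovC L M a ha P t (k + 1) - pertCovC L M a ha P t k) x.1.1 x.1.2‖
      ≤ Cpert κ (2 * d * Cst d a) (CJ d a) C₂ 0 t * ((L : ℝ)⁻¹) ^ k :=
    (norm_entry_le_opNorm _ _ _).trans (opNorm_pertCovC_succ_sub_le_geom L M a ha hP ht k)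
  rw [Matrix.sub_apply] at hent
  obtain ⟨⟨i, j⟩, b⟩ := x
  cases b with
  | true =>
    simp only [pertReadingsC, ↓reduceIte]
    rw [← Complex.sub_re]
    exact (Complex.abs_re_le_norm _).trans hent
  | false =>
    simp only [pertReadingsC, Bool.false_eq_true, ↓reduceIte]
    rw [← Complex.sub_im]
    exact (Complex.abs_im_le_norm _).trans hent

/-! ## §3 Bałaban's averaging and transported averagings, lifted -/

/-- **`FreeTowerLaws` FOR BAŁABAN's AVERAGING ON THE COLOUR LAYER** (`Q̄ ⊗ 1`, pairing defect `F ⊗ 1`, `dLCst·L^{−k}`). [cite: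
Balaban1984PropagatorsI, (1.18) p.20, Prop. 1.1 (1.89) p.33; King1986, p.664, Lemma 4.5 (4.38) p.674] [folklore] -/
theorem freeTowerLaws_balaban_kron (o : Type*) [Fintype o] [DecidableEq o] :
    FreeTowerLaws (fun k => calDalev L M a ha k ⊗ₖ (1 : Matrix o o ℂ)) (fun k => QBlev L M k ⊗ₖ (1 : Matrix o o ℂ))
      (fun k => JpcT L M k ⊗ₖ (1 : Matrix o o ℂ)) (fun k => FQBlev L M k ⊗ₖ (1 : Matrix o o ℂ)) ((L : ℝ) ^ d)
      (fun k => 2 * d * Cst d a * ((L : ℝ)⁻¹) ^ k) (fun k => CJ d a * ((L : ℝ)⁻¹) ^ k) (fun k => d * L * Cst d a * ((L : ℝ)⁻¹) ^ k) :=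
  freeTowerLaws_kron o (freeTowerLaws_balaban L M a ha)

/-- **THE PERTURBED COLOUR η-RATE WITH BAŁABAN's AVERAGING** (`L ≥ 2`): the `(Q̄ ⊗ 1)`-sandwiched colour covariances of
`(Δ_a^{(k)} ⊗ 1 + tP_k)⁻¹` converge with rate `L^{−k}`, constant `Cpert κ (2dCst) CJ C₂ (dLCst) t`. [cite: King1986, Lemma 4.5 (4.32)/(4.38)
p.674; Balaban1984PropagatorsI, (1.18) p.20, Prop. 1.1 (1.89) p.33] [folklore] -/
theorem towerLimitRate_perturbed_balaban_kron (hL : 2 ≤ L) {P : (k : ℕ) → Matrix (idx L M k × o) (idx L M k × o) ℂ} {κ C₂ : ℝ}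
    (hpert : PerturbationLaws (fun k => calDalev L M a ha k ⊗ₖ (1 : Matrix o o ℂ)) P (fun k => JpcT L M k ⊗ₖ (1 : Matrix o o ℂ)) κ
      (fun k => C₂ * ((L : ℝ)⁻¹) ^ k)) {t : ℂ} (ht : ‖t‖ * κ < 1) :
    TowerLimitRate (fun k => QBlev L M k ⊗ₖ (1 : Matrix o o ℂ)) ((L : ℝ) ^ d)
      (fun k => (calDalev L M a ha k ⊗ₖ (1 : Matrix o o ℂ) + t • P k)⁻¹)
      (Cpert κ (2 * d * Cst d a) (CJ d a) C₂ (d * L * Cst d a) t) ((L : ℝ)⁻¹) := by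
  have hL1 : (1 : ℝ) < L := by exact_mod_cast (lt_of_lt_of_le one_lt_two hL : 1 < L)
  exact towerLimitRate_perturbed (pow_d_pos (d := d) L) (freeTowerLaws_balaban_kron L M a ha o) hpert (inv_lt_one_of_one_lt₀ hL1)
    (fun k => le_rfl) (fun k => le_rfl) (fun k => le_rfl) (fun k => le_rfl) ht

/-- **`FreeTowerLaws` FOR THE (ABELIAN) TRANSPORTED AVERAGINGS ON THE COLOUR LAYER** (`Acov u ⊗ 1`, `UnimodularTransport u γ`). [folklore] -/
theorem freeTowerLaws_covariant_kron (o : Type*) [Fintype o] [DecidableEq o] {u : (k : ℕ) → (idx L M (k + 1) → ℂ)} {γ : ℝ}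
    (hu : UnimodularTransport L M u γ) :
    FreeTowerLaws (fun k => calDalev L M a ha k ⊗ₖ (1 : Matrix o o ℂ)) (fun k => Acov L M u k ⊗ₖ (1 : Matrix o o ℂ))
      (fun k => JpcT L M k ⊗ₖ (1 : Matrix o o ℂ)) (fun k => Fcov L M u k ⊗ₖ (1 : Matrix o o ℂ)) ((L : ℝ) ^ d)
      (fun k => 2 * d * Cst d a * ((L : ℝ)⁻¹) ^ k) (fun k => CJ d a * ((L : ℝ)⁻¹) ^ k) (fun k => γ * Cst d a * ((L : ℝ)⁻¹) ^ k) :=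
  freeTowerLaws_kron o (freeTowerLaws_covariant L M a ha hu)

/-- **THE PERTURBED COLOUR η-RATE WITH TRANSPORTED AVERAGING** (`L ≥ 2`): for every `UnimodularTransport u γ`, every family `P` in the
class and every `‖t‖κ < 1`, rate `L^{−k}` with constant `Cpert κ (2dCst) CJ C₂ (γCst) t`. [cite: King1986, Lemma 4.5 (4.32)/(4.38) p.674;
Balaban1985BackgroundPropagators, (3.18)-(3.19) p.393 (shape)] [folklore] -/
theorem towerLimitRate_perturbed_covariant_kron (hL : 2 ≤ L) {u : (k : ℕ) → (idx L M (k + 1) → ℂ)} {γ : ℝ}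
    (hu : UnimodularTransport L M u γ) {P : (k : ℕ) → Matrix (idx L M k × o) (idx L M k × o) ℂ} {κ C₂ : ℝ}
    (hpert : PerturbationLaws (fun k => calDalev L M a ha k ⊗ₖ (1 : Matrix o o ℂ)) P (fun k => JpcT L M k ⊗ₖ (1 : Matrix o o ℂ)) κ
      (fun k => C₂ * ((L : ℝ)⁻¹) ^ k)) {t : ℂ} (ht : ‖t‖ * κ < 1) :
    TowerLimitRate (fun k => Acov L M u k ⊗ₖ (1 : Matrix o o ℂ)) ((L : ℝ) ^ d)
      (fun k => (calDalev L M a ha k ⊗ₖ (1 : Matrix o o ℂ) + t • P k)⁻¹)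
      (Cpert κ (2 * d * Cst d a) (CJ d a) C₂ (γ * Cst d a) t) ((L : ℝ)⁻¹) := by
  have hL1 : (1 : ℝ) < L := by exact_mod_cast (lt_of_lt_of_le one_lt_two hL : 1 < L)
  exact towerLimitRate_perturbed (pow_d_pos (d := d) L) (freeTowerLaws_covariant_kron L M a ha o hu) hpert (inv_lt_one_of_one_lt₀ hL1)
    (fun k => le_rfl) (fun k => le_rfl) (fun k => le_rfl) (fun k => le_rfl) ht

/-! ## §4 Row B2 through these stations -/

/-- **`LocalRate` FOR THE NON-ABELIAN COVARIANT-LAPLACIAN SPECIES** (`d ≥ 1`): the colour readings class at `κ_col, C₂^col` contains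
`covPertC L M R` for every transporter tower with entrywise `LipschitzBackground` / `BoundedBackground` data, so `localRate_pertCovC`
applies to it. [folklore] -/
theorem colourCovariantLaplacian_mem_readings (hd : 1 ≤ d) {R : (k : ℕ) → Fin d → (idx L M k → Matrix o o ℂ)} {α β α' β' : ℝ}
    (hV : ∀ p : o × o, LipschitzBackground L M (Vab L M R p) α β) (hz : ∀ p : o × o, BoundedBackground L M (Zab L M R p) α' β')
    (t : ℂ) : covPertC L M R ∈ (pertReadingsC L M a ha o (kappaCol o d a α β α') (C2col o d L a α β β') t).dom :=
  perturbationLaws_colourCovariantLaplacian L M a ha hd hV hz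

/-- the `LocalRate` instance at `κ_col`, `C₂^col` (every `‖t‖κ_col < 1`). [folklore] -/
theorem colourCovariantLaplacian_localRate (α β α' β' : ℝ) {t : ℂ} (ht : ‖t‖ * kappaCol o d a α β α' < 1) :
    LocalRate (pertReadingsC L M a ha o (kappaCol o d a α β α') (C2col o d L a α β β') t)
      (Cpert (kappaCol o d a α β α') (2 * d * Cst d a) (CJ d a) (C2col o d L a α β β') 0 t) ((L : ℝ)⁻¹) :=
  localRate_pertCovC L M a ha (kappaCol o d a α β α') (C2col o d L a α β β') ht

/-- **ROW B2 WITH BAŁABAN's AVERAGING** (`L ≥ 2`, `d ≥ 1`). [folklore] -/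
theorem colourCovariantLaplacian_rate_balaban (hL : 2 ≤ L) (hd : 1 ≤ d) {R : (k : ℕ) → Fin d → (idx L M k → Matrix o o ℂ)}
    {α β α' β' : ℝ} (hV : ∀ p : o × o, LipschitzBackground L M (Vab L M R p) α β)
    (hz : ∀ p : o × o, BoundedBackground L M (Zab L M R p) α' β') {t : ℂ} (ht : ‖t‖ * kappaCol o d a α β α' < 1) :
    TowerLimitRate (fun k => QBlev L M k ⊗ₖ (1 : Matrix o o ℂ)) ((L : ℝ) ^ d)
      (fun k => (calDalev L M a ha k ⊗ₖ (1 : Matrix o o ℂ) + t • covPertC L M R k)⁻¹)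
      (Cpert (kappaCol o d a α β α') (2 * d * Cst d a) (CJ d a) (C2col o d L a α β β') (d * L * Cst d a) t) ((L : ℝ)⁻¹) :=
  towerLimitRate_perturbed_balaban_kron L M a ha hL (perturbationLaws_colourCovariantLaplacian L M a ha hd hV hz) ht

/-- **ROW B2 WITH TRANSPORTED AVERAGING** (`L ≥ 2`, `d ≥ 1`, `UnimodularTransport u γ`). [folklore] -/
theorem colourCovariantLaplacian_rate_transported (hL : 2 ≤ L) (hd : 1 ≤ d) {u : (k : ℕ) → (idx L M (k + 1) → ℂ)} {γ : ℝ}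
    (hu : UnimodularTransport L M u γ) {R : (k : ℕ) → Fin d → (idx L M k → Matrix o o ℂ)} {α β α' β' : ℝ}
    (hV : ∀ p : o × o, LipschitzBackground L M (Vab L M R p) α β) (hz : ∀ p : o × o, BoundedBackground L M (Zab L M R p) α' β')
    {t : ℂ} (ht : ‖t‖ * kappaCol o d a α β α' < 1) :
    TowerLimitRate (fun k => Acov L M u k ⊗ₖ (1 : Matrix o o ℂ)) ((L : ℝ) ^ d)
      (fun k => (calDalev L M a ha k ⊗ₖ (1 : Matrix o o ℂ) + t • covPertC L M R k)⁻¹)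
      (Cpert (kappaCol o d a α β α') (2 * d * Cst d a) (CJ d a) (C2col o d L a α β β') (γ * Cst d a) t) ((L : ℝ)⁻¹) :=
  towerLimitRate_perturbed_covariant_kron L M a ha hL hu (perturbationLaws_colourCovariantLaplacian L M a ha hd hV hz) ht

end Summit.QuantumFields.BalabanUV.T4Continuum.ColourPerturbedStations

end
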